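import Mathlib.Analysis.Calculus.ContDiff.Basic
import Mathlib.Analysis.Calculus.ContDiff.Operations
import Mathlib.Analysis.SpecialFunctions.Pow.Real
import Mathlib.Analysis.SpecialFunctions.Sqrt
import HarnessLib

/-!
# Parabolic rescaling of space–time fields and scale-invariant derivative bounds

Analysis/FluidPDE support file on the discharge path of the named fact
`Literature.Analysis.FluidPDE.knss2009_local_smoothing` (`NSBoundedMildSmoothing.lean`;
Koch–Nadirashvili–Seregin–Šverák, Acta Math. 203 (2009) = arXiv:0709.3599, Prop. 4.1: the
parabolic smoothing estimates `‖t^{k/2+l} ∇ᵏₓ ∂ₜˡ u‖_∞ ≤ C(k,l) ‖u₀‖_∞` of bounded mild solutions).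
The weights `(νt)^{k/2} tˡ` of these estimates are exactly the factors picked up by the mixed
partial derivatives under the **parabolic rescaling about the initial time at scale `t₀`**,

  `parabolicRescale ν t₀ w (θ, ξ) = w (t₀ θ, √(ν t₀) ξ)`,

which maps solutions of the Navier–Stokes (Oseen integral) equation with viscosity `ν` to
solutions with viscosity `1` (KNSS 2009, §1 (1.3): `u(x,t) ↦ λu(λx, λ²t)`; here without the
amplitude factor). Weighted derivative bounds of all orders are therefore encoded
*isotropically* as bounds on the **joint** iterated derivatives `D^m (parabolicRescale ν t₀ w)`
at the unit height `θ = 1`, uniformly in the scale `t₀`: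

* `parabolicRescale`, `IsWeightedSmooth ν T w` (jointly `C^∞` on the slab `(0, T) × E` with
  finite scale-invariant bounds of every order) and `HasWeightedBound ν T N w C` (the bounds of
  orders `≤ N` by the constant `C`) — the bookkeeping classes of the Picard iteration in weighted
  norms (KNSS 2009, §4 p. 8: "an estimate of `B` … in spaces with norms given by [(4.5)]");
* change of scale (`parabolicRescale_eq_comp_scaleChange`): the rescaling at scale `t₀` is the
  rescaling at scale `t₀ θ'` composed with the linear map `(θ, ξ) ↦ (θ/θ', ξ/√θ')`, whence bounds
  at every height `θ' ≥ 1/4` from bounds at height `1` (`norm_iteratedFDeriv_parabolicRescale_le_of_hasWeightedBound`,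
  the factor `4^m`);
* smoothness transfer between the slab and its rescalings, algebra (`sub`), and the pointwise
  bound of order zero.

## References

* G. Koch, N. Nadirashvili, G. Seregin, V. Šverák, *Liouville theorems for the Navier–Stokes
  equations and applications*, Acta Math. 203 (2009) = arXiv:0709.3599, §1 (1.3), §4 Prop. 4.1
  and the paragraph following it. [KochNadirashviliSereginSverak2009]
* Y. Giga, K. Inui, S. Matsui, *On the Cauchy problem for the Navier–Stokes equations with
  nondecaying initial data*, Quad. Mat. 4 (1999) (the weighted norms `sup t^{k/2}‖∇ᵏu(t)‖_∞`).
-/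

noncomputable section

open Set Function Filter Metric Real
open scoped Topology ContDiff

namespace Literature.Analysis.FluidPDE

variable {E : Type*} [NormedAddCommGroup E] [NormedSpace ℝ E]
  {F : Type*} [NormedAddCommGroup F] [NormedSpace ℝ F]

/-! ### The rescaling and the scale change -/

/-- **Parabolic rescaling about the initial time** at scale `t₀` with viscosity `ν`:
`parabolicRescale ν t₀ w (θ, ξ) = w (t₀ θ) (√(ν t₀) • ξ)`, as a function of the joint variable
`(θ, ξ) ∈ ℝ × E` (KNSS 2009, §1 (1.3), the Navier–Stokes scaling, normalising also the
viscosity). Meaningful for `ν, t₀ > 0`. [cite: KochNadirashviliSereginSverak2009, §1 (1.3) (arXiv:0709.3599)] -/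
def parabolicRescale (ν t₀ : ℝ) (w : ℝ → E → F) : ℝ × E → F :=
  fun p => w (t₀ * p.1) (Real.sqrt (ν * t₀) • p.2)

omit [NormedAddCommGroup F] [NormedSpace ℝ F] in
/-- Unfolding `parabolicRescale`. [folklore] -/
@[simp]
theorem parabolicRescale_apply (ν t₀ : ℝ) (w : ℝ → E → F) (p : ℝ × E) :
    parabolicRescale ν t₀ w p = w (t₀ * p.1) (Real.sqrt (ν * t₀) • p.2) := rfl

omit [NormedSpace ℝ F] in
/-- The rescaling is linear in the field: differences. [folklore] -/
theorem parabolicRescale_sub (ν t₀ : ℝ) (v w : ℝ → E → F) :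
    parabolicRescale ν t₀ (v - w) = parabolicRescale ν t₀ v - parabolicRescale ν t₀ w := rfl

omit [NormedSpace ℝ F] in
/-- The rescaling is linear in the field: negation. [folklore] -/
theorem parabolicRescale_neg (ν t₀ : ℝ) (w : ℝ → E → F) :
    parabolicRescale ν t₀ (-w) = -parabolicRescale ν t₀ w := rfl

omit [NormedSpace ℝ F] in
/-- The rescaling is linear in the field: sums. [folklore] -/
theorem parabolicRescale_add (ν t₀ : ℝ) (v w : ℝ → E → F) :
    parabolicRescale ν t₀ (v + w) = parabolicRescale ν t₀ v + parabolicRescale ν t₀ w := rfl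

/-- The rescaling is linear in the field: scalar multiples. [folklore] -/
theorem parabolicRescale_const_smul (ν t₀ c : ℝ) (w : ℝ → E → F) :
    parabolicRescale ν t₀ (c • w) = c • parabolicRescale ν t₀ w := rfl

/-- The **anisotropic dilation** `(θ, ξ) ↦ (a θ, b • ξ)` of `ℝ × E` as a continuous linear map.
[folklore] -/
def scaleCLM (a b : ℝ) : (ℝ × E) →L[ℝ] ℝ × E :=
  (a • ContinuousLinearMap.fst ℝ ℝ E).prod (b • ContinuousLinearMap.snd ℝ ℝ E)

omit [NormedSpace ℝ F] in
/-- Unfolding `scaleCLM`. [folklore] -/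
@[simp]
theorem scaleCLM_apply (a b : ℝ) (p : ℝ × E) : scaleCLM a b p = (a * p.1, b • p.2) := rfl

/-- The anisotropic dilation with nonzero factors as a continuous linear equivalence.
[folklore] -/
def scaleCLE {a b : ℝ} (ha : a ≠ 0) (hb : b ≠ 0) : (ℝ × E) ≃L[ℝ] ℝ × E :=
  ContinuousLinearEquiv.equivOfInverse (scaleCLM (E := E) a b) (scaleCLM a⁻¹ b⁻¹)
    (fun p => by ext <;> simp [ha, hb, smul_smul])
    (fun p => by ext <;> simp [ha, hb, smul_smul])

omit [NormedSpace ℝ F] in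
/-- Unfolding `scaleCLE`. [folklore] -/
@[simp]
theorem scaleCLE_apply {a b : ℝ} (ha : a ≠ 0) (hb : b ≠ 0) (p : ℝ × E) :
    scaleCLE ha hb p = (a * p.1, b • p.2) := rfl

omit [NormedSpace ℝ F] in
/-- **Operator norm of the dilation**: `‖(θ, ξ) ↦ (a θ, b • ξ)‖ ≤ max |a| |b|` (sup norm on the
product). [folklore] -/
theorem norm_scaleCLM_le (a b : ℝ) : ‖(scaleCLM a b : (ℝ × E) →L[ℝ] ℝ × E)‖ ≤ max |a| |b| := by
  refine ContinuousLinearMap.opNorm_le_bound _ (le_max_of_le_left (abs_nonneg a)) fun p => ?_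
  rw [scaleCLM_apply, Prod.norm_def, Prod.norm_def]
  refine max_le ?_ ?_
  · calc ‖a * p.1‖ = |a| * ‖p.1‖ := by rw [norm_mul, Real.norm_eq_abs]
      _ ≤ max |a| |b| * max ‖p.1‖ ‖p.2‖ := by gcongr <;> simp
  · calc ‖b • p.2‖ = |b| * ‖p.2‖ := by rw [norm_smul, Real.norm_eq_abs]
      _ ≤ max |a| |b| * max ‖p.1‖ ‖p.2‖ := by gcongr <;> simp

omit [NormedAddCommGroup F] [NormedSpace ℝ F] in
/-- **Rescaling is composition with a dilation**: `parabolicRescale ν t₀ w = uncurry w ∘ scaleCLM t₀ √(νt₀)`.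
[folklore] -/
theorem parabolicRescale_eq_uncurry_comp (ν t₀ : ℝ) (w : ℝ → E → F) :
    parabolicRescale ν t₀ w = uncurry w ∘ (scaleCLM t₀ (Real.sqrt (ν * t₀)) : ℝ × E → ℝ × E) := by
  funext p
  simp [parabolicRescale]

omit [NormedAddCommGroup F] [NormedSpace ℝ F] in
/-- **Change of scale**: for `ν t₀ ≥ 0` and `θ' > 0`, the rescaling at scale `t₀` is the rescaling
at scale `t₀ θ'` composed with `(θ, ξ) ↦ (θ/θ', ξ/√θ')`:
`parabolicRescale ν t₀ w = parabolicRescale ν (t₀ θ') w ∘ scaleCLM θ'⁻¹ (√θ')⁻¹`. [folklore] -/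
theorem parabolicRescale_eq_comp_scaleChange {ν t₀ θ' : ℝ} (hνt : 0 ≤ ν * t₀) (hθ' : 0 < θ')
    (w : ℝ → E → F) :
    parabolicRescale ν t₀ w =
      parabolicRescale ν (t₀ * θ') w ∘ (scaleCLM θ'⁻¹ (Real.sqrt θ')⁻¹ : ℝ × E → ℝ × E) := by
  funext p
  have hsq : Real.sqrt (ν * (t₀ * θ')) = Real.sqrt (ν * t₀) * Real.sqrt θ' := by
    rw [← mul_assoc, Real.sqrt_mul hνt]
  have hθ0 : Real.sqrt θ' ≠ 0 := (Real.sqrt_pos.2 hθ').ne'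
  simp only [parabolicRescale, comp_apply, scaleCLM_apply, hsq, smul_smul]
  congr 1
  · field_simp
  · congr 1
    field_simp

/-! ### Derivatives under the scale change -/

/-- **Iterated derivatives under a linear change of variables on the right** (no
differentiability hypothesis is needed for an equivalence):
`D^m (f ∘ e) (p) = D^m f (e p) ∘ (e, …, e)`. [folklore] -/
theorem iteratedFDeriv_comp_continuousLinearEquiv (e : (ℝ × E) ≃L[ℝ] ℝ × E) (f : ℝ × E → F) (m : ℕ)
    (p : ℝ × E) :
    iteratedFDeriv ℝ m (f ∘ e) p =
      (iteratedFDeriv ℝ m f (e p)).compContinuousLinearMap fun _ => (e : (ℝ × E) →L[ℝ] ℝ × E) := by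
  have h := e.iteratedFDerivWithin_comp_right f uniqueDiffOn_univ (mem_univ (e p)) m
  simp only [preimage_univ, iteratedFDerivWithin_univ] at h
  exact h

/-- **Norm of the iterated derivative under a linear change of variables**:
`‖D^m (f ∘ e) (p)‖ ≤ ‖D^m f (e p)‖ ‖e‖^m`. [folklore] -/
theorem norm_iteratedFDeriv_comp_continuousLinearEquiv_le (e : (ℝ × E) ≃L[ℝ] ℝ × E) (f : ℝ × E → F)
    (m : ℕ) (p : ℝ × E) :
    ‖iteratedFDeriv ℝ m (f ∘ e) p‖ ≤
      ‖iteratedFDeriv ℝ m f (e p)‖ * ‖(e : (ℝ × E) →L[ℝ] ℝ × E)‖ ^ m := by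
  rw [iteratedFDeriv_comp_continuousLinearEquiv]
  refine (ContinuousMultilinearMap.norm_compContinuousLinearMap_le _ _).trans (le_of_eq ?_)
  rw [Finset.prod_const, Finset.card_univ, Fintype.card_fin]

/-- **Derivatives at height `θ'` from derivatives at height `1` of the rescaling at scale
`t₀ θ'`**: for `ν t₀ ≥ 0`, `θ' > 0`,
`‖D^m (parabolicRescale ν t₀ w)(θ', ξ)‖ ≤ ‖D^m (parabolicRescale ν (t₀θ') w)(1, ξ/√θ')‖ (max θ'⁻¹ (√θ')⁻¹)^m`.
[folklore] -/
theorem norm_iteratedFDeriv_parabolicRescale_le_scaleChange {ν t₀ θ' : ℝ} (hνt : 0 ≤ ν * t₀)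
    (hθ' : 0 < θ') (w : ℝ → E → F) (m : ℕ) (ξ : E) :
    ‖iteratedFDeriv ℝ m (parabolicRescale ν t₀ w) (θ', ξ)‖ ≤
      ‖iteratedFDeriv ℝ m (parabolicRescale ν (t₀ * θ') w) (1, (Real.sqrt θ')⁻¹ • ξ)‖ *
        (max θ'⁻¹ (Real.sqrt θ')⁻¹) ^ m := by
  have hθ0 : θ'⁻¹ ≠ 0 := inv_ne_zero hθ'.ne'
  have hs0 : (Real.sqrt θ')⁻¹ ≠ 0 := inv_ne_zero (Real.sqrt_pos.2 hθ').ne'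
  set e : (ℝ × E) ≃L[ℝ] ℝ × E := scaleCLE hθ0 hs0 with he
  have hcomp : parabolicRescale ν t₀ w = parabolicRescale ν (t₀ * θ') w ∘ e := by
    rw [parabolicRescale_eq_comp_scaleChange hνt hθ' w]
    rfl
  have hep : e (θ', ξ) = (1, (Real.sqrt θ')⁻¹ • ξ) := by
    rw [he, scaleCLE_apply]
    simp [hθ'.ne']
  rw [hcomp]
  refine (norm_iteratedFDeriv_comp_continuousLinearEquiv_le e _ m (θ', ξ)).trans ?_
  rw [hep]
  refine mul_le_mul_of_nonneg_left (pow_le_pow_left₀ (norm_nonneg _) ?_ m) (norm_nonneg _)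
  have h := norm_scaleCLM_le (E := E) θ'⁻¹ (Real.sqrt θ')⁻¹
  rw [abs_of_pos (inv_pos.2 hθ'), abs_of_pos (inv_pos.2 (Real.sqrt_pos.2 hθ'))] at h
  exact h

/-- For `θ' ≥ 1/4`, `max θ'⁻¹ (√θ')⁻¹ ≤ 4`. [folklore] -/
theorem max_inv_inv_sqrt_le_four {θ' : ℝ} (hθ' : 1 / 4 ≤ θ') : max θ'⁻¹ (Real.sqrt θ')⁻¹ ≤ 4 := by
  have hθ0 : 0 < θ' := lt_of_lt_of_le (by norm_num) hθ'
  refine max_le ?_ ?_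
  · rw [inv_le_comm₀ hθ0 (by norm_num)]
    linarith
  · have hs : 1 / 2 ≤ Real.sqrt θ' := by
      rw [show (1 / 2 : ℝ) = Real.sqrt (1 / 4) by
        rw [show (1 / 4 : ℝ) = (1 / 2) ^ 2 by norm_num, Real.sqrt_sq (by norm_num)]]
      exact Real.sqrt_le_sqrt hθ'
    rw [inv_le_comm₀ (lt_of_lt_of_le (by norm_num) hs) (by norm_num)]
    linarith

/-! ### Weighted smoothness classes -/

variable (ν T : ℝ)

/-- **Scale-invariant smoothness on the slab** `(0, T) × E`: `w` is jointly `C^∞` there and,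
for every order `m`, the joint iterated derivatives of its parabolic rescalings at unit height
are bounded uniformly in the scale `t₀ ∈ (0, T)` — the qualitative class carried by the Picard
iterates of the local theory (KNSS 2009, Prop. 4.1: all the weighted quantities
`t^{k/2+l}∇ᵏₓ∂ₜˡu` are bounded). [cite: KochNadirashviliSereginSverak2009, Prop. 4.1 (arXiv:0709.3599 p. 8)] -/
structure IsWeightedSmooth (w : ℝ → E → F) : Prop where
  contDiffOn : ContDiffOn ℝ ∞ (uncurry w) (Ioo 0 T ×ˢ univ)
  bound : ∀ m : ℕ, ∃ C : ℝ, ∀ t₀ ∈ Ioo 0 T, ∀ ξ : E,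
    ‖iteratedFDeriv ℝ m (parabolicRescale ν t₀ w) (1, ξ)‖ ≤ C

/-- **Scale-invariant bounds of orders `≤ N`**: `‖D^m (parabolicRescale ν t₀ w)(1, ξ)‖ ≤ C` for
all `m ≤ N`, all scales `t₀ ∈ (0, T)` and all `ξ` — the unit ball of radius `C` of the weighted
norm `max_{k+l ≤ N} sup (νt)^{k/2} tˡ ‖∇ᵏₓ∂ₜˡ w(t,x)‖` of KNSS 2009, (4.5), in isotropic form.
[cite: KochNadirashviliSereginSverak2009, (4.5) (arXiv:0709.3599 p. 8)] -/
def HasWeightedBound (N : ℕ) (w : ℝ → E → F) (C : ℝ) : Prop :=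
  ∀ t₀ ∈ Ioo 0 T, ∀ m ≤ N, ∀ ξ : E, ‖iteratedFDeriv ℝ m (parabolicRescale ν t₀ w) (1, ξ)‖ ≤ C

variable {ν T}

/-- A weighted bound is nonnegative as soon as the slab is nonempty. [folklore] -/
theorem HasWeightedBound.nonneg {N : ℕ} {w : ℝ → E → F} {C : ℝ} (h : HasWeightedBound ν T N w C)
    (hT : 0 < T) [Nonempty E] : 0 ≤ C := by
  obtain ⟨ξ⟩ := ‹Nonempty E›
  exact (norm_nonneg _).trans (h (T / 2) ⟨by linarith, by linarith⟩ 0 (Nat.zero_le _) ξ)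

/-- Monotonicity of weighted bounds in the constant. [folklore] -/
theorem HasWeightedBound.mono {N : ℕ} {w : ℝ → E → F} {C C' : ℝ} (h : HasWeightedBound ν T N w C)
    (hCC' : C ≤ C') : HasWeightedBound ν T N w C' :=
  fun t₀ ht₀ m hm ξ => (h t₀ ht₀ m hm ξ).trans hCC'

/-- Monotonicity of weighted bounds in the order. [folklore] -/
theorem HasWeightedBound.of_le {N N' : ℕ} {w : ℝ → E → F} {C : ℝ} (h : HasWeightedBound ν T N w C)
    (hN : N' ≤ N) : HasWeightedBound ν T N' w C :=
  fun t₀ ht₀ m hm ξ => h t₀ ht₀ m (hm.trans hN) ξ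

/-- Monotonicity of weighted bounds in the length of the slab. [folklore] -/
theorem HasWeightedBound.of_time_le {N : ℕ} {w : ℝ → E → F} {C : ℝ} {T' : ℝ}
    (h : HasWeightedBound ν T N w C) (hT' : T' ≤ T) : HasWeightedBound ν T' N w C :=
  fun t₀ ht₀ m hm ξ => h t₀ ⟨ht₀.1, ht₀.2.trans_le hT'⟩ m hm ξ

/-- **The order-zero bound is a pointwise bound on the slab**: every point `(t, x)` of
`(0, T) × E` is the image of `(1, x/√(νt))` under the rescaling at scale `t` (`ν > 0`).
[folklore] -/
theorem HasWeightedBound.norm_le {N : ℕ} {w : ℝ → E → F} {C : ℝ} (h : HasWeightedBound ν T N w C)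
    (hν : 0 < ν) {t : ℝ} (ht : t ∈ Ioo 0 T) (x : E) : ‖w t x‖ ≤ C := by
  have hL : 0 < Real.sqrt (ν * t) := Real.sqrt_pos.2 (mul_pos hν ht.1)
  have h0 := h t ht 0 (Nat.zero_le _) ((Real.sqrt (ν * t))⁻¹ • x)
  rw [norm_iteratedFDeriv_zero, parabolicRescale_apply] at h0
  simpa [smul_smul, hL.ne', mul_one] using h0

/-- Restriction of the qualitative class to a shorter slab. [folklore] -/
theorem IsWeightedSmooth.of_time_le {w : ℝ → E → F} (h : IsWeightedSmooth ν T w) {T' : ℝ}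
    (hT' : T' ≤ T) : IsWeightedSmooth ν T' w := by
  refine ⟨h.contDiffOn.mono (prod_mono (Ioo_subset_Ioo_right hT') subset_rfl), fun m => ?_⟩
  obtain ⟨C, hC⟩ := h.bound m
  exact ⟨C, fun t₀ ht₀ ξ => hC t₀ ⟨ht₀.1, ht₀.2.trans_le hT'⟩ ξ⟩

/-! ### Smoothness of the rescalings -/

/-- **The rescalings of a field smooth on the slab are smooth on the rescaled slab**: for
`ν, t₀ > 0`, `parabolicRescale ν t₀ w` is `C^n` on `(0, T/t₀) × E` when `uncurry w` is `C^n` on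
`(0, T) × E`. [folklore] -/
theorem contDiffOn_parabolicRescale_of_uncurry {n : WithTop ℕ∞} {w : ℝ → E → F}
    (hw : ContDiffOn ℝ n (uncurry w) (Ioo 0 T ×ˢ univ)) (ν : ℝ) {t₀ : ℝ} (ht₀ : 0 < t₀) :
    ContDiffOn ℝ n (parabolicRescale ν t₀ w) (Ioo 0 (T / t₀) ×ˢ univ) := by
  rw [parabolicRescale_eq_uncurry_comp]
  refine (hw.comp_continuousLinearMap (scaleCLM t₀ (Real.sqrt (ν * t₀)))).mono fun p hp => ?_
  obtain ⟨hp1, -⟩ := mem_prod.1 hp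
  refine mk_mem_prod ⟨mul_pos ht₀ hp1.1, ?_⟩ (mem_univ _)
  calc t₀ * p.1 < t₀ * (T / t₀) := mul_lt_mul_of_pos_left hp1.2 ht₀
    _ = T := mul_div_cancel₀ T ht₀.ne'

/-- The rescalings of a weighted-smooth field are `C^∞` on `(0, T/t₀) × E`. [folklore] -/
theorem IsWeightedSmooth.contDiffOn_parabolicRescale {w : ℝ → E → F} (h : IsWeightedSmooth ν T w)
    {t₀ : ℝ} (ht₀ : 0 < t₀) :
    ContDiffOn ℝ ∞ (parabolicRescale ν t₀ w) (Ioo 0 (T / t₀) ×ˢ univ) :=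
  contDiffOn_parabolicRescale_of_uncurry h.contDiffOn ν ht₀

/-- The rescalings of a weighted-smooth field are `C^∞` at every point of height in
`(0, T/t₀)`. [folklore] -/
theorem IsWeightedSmooth.contDiffAt_parabolicRescale {w : ℝ → E → F} (h : IsWeightedSmooth ν T w)
    {t₀ : ℝ} (ht₀ : 0 < t₀) {p : ℝ × E} (hp1 : 0 < p.1) (hp2 : t₀ * p.1 < T) :
    ContDiffAt ℝ ∞ (parabolicRescale ν t₀ w) p := by
  refine (h.contDiffOn_parabolicRescale ht₀).contDiffAt
    ((isOpen_Ioo.prod isOpen_univ).mem_nhds (mk_mem_prod ⟨hp1, ?_⟩ (mem_univ _)))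
  rwa [lt_div_iff₀ ht₀, mul_comm]

/-- **Smoothness on the slab from smoothness of the rescalings near unit height**: if for
every scale `t₀ ∈ (0, T)` the rescaling `parabolicRescale ν t₀ w` is `C^n` on some
`(a, b) × E` with `a < 1 < b`, then `uncurry w` is `C^n` on `(0, T) × E` (`ν > 0`; near height
`t₀` the field is its rescaling composed with the inverse dilation). [folklore] -/
theorem contDiffOn_uncurry_of_parabolicRescale {n : WithTop ℕ∞} {w : ℝ → E → F} (hν : 0 < ν)
    (h : ∀ t₀ ∈ Ioo 0 T, ∃ a b : ℝ, a < 1 ∧ 1 < b ∧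
      ContDiffOn ℝ n (parabolicRescale ν t₀ w) (Ioo a b ×ˢ univ)) :
    ContDiffOn ℝ n (uncurry w) (Ioo 0 T ×ˢ univ) := by
  refine contDiffOn_of_locally_contDiffOn fun p hp => ?_
  obtain ⟨hpt, -⟩ := mem_prod.1 hp
  obtain ⟨a, b, ha, hb, hs⟩ := h p.1 hpt
  have ht : 0 < p.1 := hpt.1
  have hL : 0 < Real.sqrt (ν * p.1) := Real.sqrt_pos.2 (mul_pos hν ht)
  set e : (ℝ × E) →L[ℝ] ℝ × E := scaleCLM p.1⁻¹ (Real.sqrt (ν * p.1))⁻¹ with he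
  refine ⟨Ioo (p.1 * a) (p.1 * b) ×ˢ univ, isOpen_Ioo.prod isOpen_univ,
    mk_mem_prod ⟨by nlinarith, by nlinarith⟩ (mem_univ _), ?_⟩
  have hcomp : ∀ q : ℝ × E, (parabolicRescale ν p.1 w ∘ e) q = uncurry w q := by
    intro q
    simp only [comp_apply, he, scaleCLM_apply, parabolicRescale_apply, uncurry, smul_smul]
    rw [← mul_assoc, mul_inv_cancel₀ ht.ne', one_mul, mul_inv_cancel₀ hL.ne', one_smul]
  have hpre : Ioo 0 T ×ˢ (univ : Set E) ∩ Ioo (p.1 * a) (p.1 * b) ×ˢ univ ⊆ e ⁻¹' (Ioo a b ×ˢ univ) := by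
    rintro q ⟨-, hq⟩
    obtain ⟨hq1, -⟩ := mem_prod.1 hq
    refine mk_mem_prod ⟨?_, ?_⟩ (mem_univ _)
    · show a < p.1⁻¹ * q.1
      rw [lt_inv_mul_iff₀ ht]; exact hq1.1
    · show p.1⁻¹ * q.1 < b
      rw [inv_mul_lt_iff₀ ht]; exact hq1.2
  exact ((hs.comp_continuousLinearMap e).mono hpre).congr fun q _ => (hcomp q).symm

/-! ### Bounds at other heights -/

/-- **Bounds at heights `θ' ≥ 1/4`**: if `‖D^m (parabolicRescale ν t w)(1, ·)‖ ≤ C` for all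
scales `t ∈ (0, T)` and orders `m ≤ N`, then at every scale `t₀` and every height `θ' ≥ 1/4` with
`t₀ θ' < T`, `‖D^m (parabolicRescale ν t₀ w)(θ', ξ)‖ ≤ 4^m C` (`m ≤ N`, `ν > 0`, `t₀ > 0`).
[folklore] -/
theorem HasWeightedBound.norm_iteratedFDeriv_le {N : ℕ} {w : ℝ → E → F} {C : ℝ}
    (h : HasWeightedBound ν T N w C) (hν : 0 < ν) {t₀ : ℝ} (ht₀ : 0 < t₀) {θ' : ℝ}
    (hθ' : 1 / 4 ≤ θ') (hθT : t₀ * θ' < T) {m : ℕ} (hm : m ≤ N) (ξ : E) :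
    ‖iteratedFDeriv ℝ m (parabolicRescale ν t₀ w) (θ', ξ)‖ ≤ 4 ^ m * C := by
  have hθ0 : 0 < θ' := lt_of_lt_of_le (by norm_num) hθ'
  have hνt : 0 ≤ ν * t₀ := (mul_pos hν ht₀).le
  have h1 := norm_iteratedFDeriv_parabolicRescale_le_scaleChange hνt hθ0 w m ξ
  have h2 := h (t₀ * θ') ⟨mul_pos ht₀ hθ0, hθT⟩ m hm ((Real.sqrt θ')⁻¹ • ξ)
  have hC : 0 ≤ C := (norm_nonneg _).trans h2
  have h4 : (max θ'⁻¹ (Real.sqrt θ')⁻¹) ^ m ≤ 4 ^ m :=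
    pow_le_pow_left₀ (le_max_of_le_left (inv_nonneg.2 hθ0.le)) (max_inv_inv_sqrt_le_four hθ') m
  calc ‖iteratedFDeriv ℝ m (parabolicRescale ν t₀ w) (θ', ξ)‖
      ≤ ‖iteratedFDeriv ℝ m (parabolicRescale ν (t₀ * θ') w) (1, (Real.sqrt θ')⁻¹ • ξ)‖ *
          (max θ'⁻¹ (Real.sqrt θ')⁻¹) ^ m := h1
    _ ≤ C * 4 ^ m := mul_le_mul h2 h4 (pow_nonneg (le_max_of_le_left (inv_nonneg.2 hθ0.le)) m) hC
    _ = 4 ^ m * C := mul_comm _ _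

/-- **Finite-order bounds of a weighted-smooth field**: for every `N` there is `C ≥ 0` with
`HasWeightedBound ν T N w C` (the maximum of the bounds of orders `≤ N`). [folklore] -/
theorem IsWeightedSmooth.exists_hasWeightedBound {w : ℝ → E → F} (h : IsWeightedSmooth ν T w)
    (N : ℕ) : ∃ C : ℝ, 0 ≤ C ∧ HasWeightedBound ν T N w C := by
  induction N with
  | zero =>
    obtain ⟨C, hC⟩ := h.bound 0
    refine ⟨max C 0, le_max_right _ _, fun t₀ ht₀ m hm ξ => ?_⟩
    rw [Nat.le_zero.1 hm]
    exact (hC t₀ ht₀ ξ).trans (le_max_left _ _)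
  | succ N ih =>
    obtain ⟨C, hC0, hC⟩ := ih
    obtain ⟨C', hC'⟩ := h.bound (N + 1)
    refine ⟨max C C', le_max_of_le_left hC0, fun t₀ ht₀ m hm ξ => ?_⟩
    rcases Nat.of_le_succ hm with hle | heq
    · exact (hC t₀ ht₀ m hle ξ).trans (le_max_left _ _)
    · rw [heq]
      exact (hC' t₀ ht₀ ξ).trans (le_max_right _ _)

/-- The same at all heights `θ' ≥ 1/4`: at every order there is a bound valid at all such
heights and all scales. [folklore] -/
theorem IsWeightedSmooth.exists_norm_iteratedFDeriv_le {w : ℝ → E → F} (h : IsWeightedSmooth ν T w)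
    (hν : 0 < ν) (m : ℕ) :
    ∃ C : ℝ, 0 ≤ C ∧ ∀ ⦃t₀ : ℝ⦄, 0 < t₀ → ∀ ⦃θ' : ℝ⦄, 1 / 4 ≤ θ' → t₀ * θ' < T → ∀ ξ : E,
      ‖iteratedFDeriv ℝ m (parabolicRescale ν t₀ w) (θ', ξ)‖ ≤ C := by
  obtain ⟨C, hC0, hC⟩ := h.exists_hasWeightedBound m
  exact ⟨4 ^ m * C, by positivity, fun t₀ ht₀ θ' hθ' hθT ξ =>
    hC.norm_iteratedFDeriv_le hν ht₀ hθ' hθT le_rfl ξ⟩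

/-! ### Algebra -/

/-- Weighted bounds of a difference. [folklore] -/
theorem HasWeightedBound.sub {N : ℕ} {v w : ℝ → E → F} {Cv Cw : ℝ} (hv : HasWeightedBound ν T N v Cv)
    (hw : HasWeightedBound ν T N w Cw) (hvs : IsWeightedSmooth ν T v) (hws : IsWeightedSmooth ν T w) :
    HasWeightedBound ν T N (v - w) (Cv + Cw) := by
  intro t₀ ht₀ m hm ξ
  have hT : t₀ * 1 < T := by rw [mul_one]; exact ht₀.2
  have hva := hvs.contDiffAt_parabolicRescale ht₀.1 (p := (1, ξ)) one_pos hT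
  have hwa := hws.contDiffAt_parabolicRescale ht₀.1 (p := (1, ξ)) one_pos hT
  rw [parabolicRescale_sub, iteratedFDeriv_sub_apply (hva.of_le (mod_cast le_top)) (hwa.of_le (mod_cast le_top))]
  exact (norm_sub_le _ _).trans (add_le_add (hv t₀ ht₀ m hm ξ) (hw t₀ ht₀ m hm ξ))

/-- The weighted-smooth class is closed under differences. [folklore] -/
theorem IsWeightedSmooth.sub {v w : ℝ → E → F} (hv : IsWeightedSmooth ν T v) (hw : IsWeightedSmooth ν T w) :
    IsWeightedSmooth ν T (v - w) := by
  refine ⟨?_, fun m => ?_⟩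
  · have h := hv.contDiffOn.sub hw.contDiffOn
    exact h.congr fun p _ => by simp [uncurry]
  · obtain ⟨Cv, -, hCv⟩ := hv.exists_hasWeightedBound m
    obtain ⟨Cw, -, hCw⟩ := hw.exists_hasWeightedBound m
    exact ⟨Cv + Cw, fun t₀ ht₀ ξ => (hCv.sub hCw hv hw) t₀ ht₀ m le_rfl ξ⟩

/-- The weighted-smooth class is closed under negation. [folklore] -/
theorem IsWeightedSmooth.neg {w : ℝ → E → F} (hw : IsWeightedSmooth ν T w) :
    IsWeightedSmooth ν T (-w) := by
  refine ⟨?_, fun m => ?_⟩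
  · exact hw.contDiffOn.neg.congr fun p _ => by simp [uncurry]
  · obtain ⟨C, hC⟩ := hw.bound m
    refine ⟨C, fun t₀ ht₀ ξ => ?_⟩
    rw [parabolicRescale_neg, iteratedFDeriv_neg_apply, norm_neg]
    exact hC t₀ ht₀ ξ

/-- Weighted bounds of a negation. [folklore] -/
theorem HasWeightedBound.neg {N : ℕ} {w : ℝ → E → F} {C : ℝ} (hw : HasWeightedBound ν T N w C) :
    HasWeightedBound ν T N (-w) C := by
  intro t₀ ht₀ m hm ξ
  rw [parabolicRescale_neg, iteratedFDeriv_neg_apply, norm_neg]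
  exact hw t₀ ht₀ m hm ξ

/-! ### Measurability and continuity on the slab -/

/-- A weighted-smooth field is continuous on the slab. [folklore] -/
theorem IsWeightedSmooth.continuousOn {w : ℝ → E → F} (h : IsWeightedSmooth ν T w) :
    ContinuousOn (uncurry w) (Ioo 0 T ×ˢ univ) :=
  h.contDiffOn.continuousOn

end Literature.Analysis.FluidPDE

end
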